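import Mathlib
import HarnessLib
import Summits.Ventures.LatticeQCDFlow.Exactness.SphereFlowLiouville

/-!
# The exact residual action of flow-HMC on the lattice of site spheres: the map `Φ_{s→c}` of ANY jointly `C³` flow transports `e^{−sS}π̄` to `e^{−cS}π̄` reweighted by `exp(−∫_s^c (S − 𝓛_uG_u)∘Φ_{s→u} du)` — the exponential of the integrated residual of Lüscher's equation — and `cS∘Φ_{0→c} − ln J_{0→c} = ∫_0^c (S − 𝓛_uG_u)∘Φ_{0→u} du` is the effective action whose HMC samples `e^{−cS}` exactly

HONEST FRAMING: exact (Metropolis-corrected) sampling algorithms for lattice gauge theory;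
figures of merit are autocorrelation/cost numbers at stated couplings and volumes; no
continuum-physics claim.

Venture `LatticeQCDFlow` (cell pub-lqcd), topic `Exactness`; FANOUT row 7 (`s0-cpn-null`: the
S0-D1 rung — 2D CP⁹, Lüscher's LO trivializing map inside HMC, Engel–Schaefer 2011).  NEW WORK of
the cell over the tree's `Exactness/SphereFlowLiouville.lean` (this leg: the log-Jacobian
`ℓ_{s→c} = ln J_{s→c}` of the evolution map by Liouville's formula and the change of variables
`∫ e^{ℓ_{s→c}}·(H∘Φ_{s→c}) dπ̄ = ∫ H dπ̄`), `Exactness/SphereTimeDependentFlow.lean` (GEN-14: the flow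
`Φ_{t₀→t}`, the true equation in the window), `Exactness/SphereGradientFlowPullback.lean`
(`DS·∂̃G = Σ⟨∂̃S, ∂̃G⟩` on `Ω̃`) and `Exactness/SphereTiltedGreen.lean` (Lüscher's operator `𝓛_t`);
nothing is cited as a fact.  Printed counterpart, NAMED ONLY: M. Lüscher, Commun. Math. Phys. 293
(2010) 899, §3 eqs. (3.4)–(3.9) (the pulled-back action `S(Φ_t(V)) − ln det Φ_t^*(V)` of the
trivialized theory and its `t`-derivative `{S − 𝓛_tS̃_t}∘Φ_t` up to constants — eq. (3.9) with
(4.5)); G. P. Engel, S. Schaefer, Comput. Phys. Commun. 182 (2011) 2107, §3 eq. (18) (the HMC in the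
variables `V = Φ^{-1}(U)` with exactly this action).  GEN-14 listed "the residual action" as NOT
CLAIMED; THIS FILE types it, for every jointly `C³` generator, with no smallness or solvability
hypothesis:

* §1 **EXACT REWEIGHTING OF THE FLOW MAP** (**`integral_exp_sphereTDFlowLogJac_sub_mul_comp`**):
  for `|s|, |c| ≤ |T| + 1`, `S ∈ C¹`, every real `t` and every `C¹` observable `H`,
  `∫ exp(ℓ_{s→c}(ω) − tS(Φ_{s→c}ω))·H(Φ_{s→c}ω) dπ̄(ω) = ∫ e^{−tS}H dπ̄`
  — drawing `y` from `e^{−S_eff}π̄/Z` with THE EFFECTIVE ACTION `S_eff = tS∘Φ_{s→c} − ℓ_{s→c}` and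
  mapping `x = Φ_{s→c}(y)` samples `e^{−tS}π̄/Z_t` EXACTLY, with the same normalising constant
  (**`tiltedMean_effAction_comp_sphereTDFlow_eq`**: `⟨H∘Φ_{s→c}⟩_{S_eff} = ⟨H⟩_{tS}`); the time-`0`
  Liouville statement **`integral_exp_neg_intervalIntegral_mul_comp_sphereTDFlow_zero`**;
* §2 **THE EFFECTIVE ACTION IS THE INTEGRATED RESIDUAL OF LÜSCHER'S EQUATION**
  (**`mul_action_comp_sub_sphereTDFlowLogJac_eq_intervalIntegral`**): on `Ω̃`, for `|s|, |c| ≤ |T|+1`,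
  `c·S(Φ_{s→c}x) − s·S(x) − ℓ_{s→c}(x) = ∫_s^c (S − 𝓛_uG_u)(Φ_{s→u}x) du`
  (differentiate `u ↦ uS(Φ_{s→u}x)` along the true equation `ẋ = −∂̃G_u(x)`: `S − uΣ⟨∂̃S, ∂̃G_u⟩`,
  and add the Laplacian from `ℓ`: `S − (−Σ∂̃²G_u + uΣ⟨∂̃S, ∂̃G_u⟩) = S − 𝓛_uG_u`);
* §3 **THE TRANSPORT LAW BETWEEN TILTS** (**`integral_exp_neg_mul_mul_exp_neg_residual_mul_comp`**):
  `∫ e^{−sS(ω)}·exp(−∫_s^c (S − 𝓛_uG_u)(Φ_{s→u}ω)du)·H(Φ_{s→c}ω) dπ̄(ω) = ∫ e^{−cS}H dπ̄`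
  — the law `e^{−sS}π̄` transported by ANY flow from time `s` to time `c` is `e^{−cS}π̄` reweighted by
  the exponential of the integrated residual; in particular (**`tiltedMean_comp_sphereTDFlow_eq_of_luscher`**)
  IF `𝓛_uG_u = S + C_u` on `Ω` between `s` and `c` the weight is constant and
  `⟨H∘Φ_{s→c}⟩_s = ⟨H⟩_c`: Lüscher's theorem between ANY two flow times in the window (GEN-14's
  `luscher_trivialization` is `s = 0`), now through the Jacobian as in Lüscher's own argument.

NOT CLAIMED: the VARIANCE of the residual weight / acceptance rates of the corrected algorithm (the
identities are exact; their statistical cost is not estimated); generators that are only jointly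
`C²`; anything about the discretised (Euler / Runge–Kutta) map actually run by the rung, whose
Jacobian is GEN-6/GEN-9's business; autocorrelations or the rung's numbers.
-/

noncomputable section

namespace Summit.Ventures.LatticeQCDFlow.Exactness

open Function Set Metric MeasureTheory NormedSpace InnerProductSpace
open scoped RealInnerProductSpace Topology

variable {Λ : Type*} {E : Type*} [NormedAddCommGroup E] [InnerProductSpace ℝ E]
  [FiniteDimensional ℝ E] [Fintype Λ] [DecidableEq Λ]

/-! ## §1 Exact reweighting of the flow map -/

section Reweighting

variable [MeasurableSpace E] [BorelSpace E] [Nontrivial E] {G : ℝ → (Λ → E) → ℝ} {T : ℝ}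

/-- **Liouville's theorem from time `0`**: for `|c| ≤ |T| + 1` and `H ∈ C¹`,
`∫ exp(−∫_0^c Σ_n∂̃_n·∂̃_nG_u(Φ_{0→u}ω) du)·H(Φ_{0→c}ω) dπ̄(ω) = ∫ H dπ̄` — the Jacobian of the
trivializing map `Φ_{0→c}` with respect to `π̄` is `J_c(ω) = exp(−∫_0^c Σ_n∂̃²_nG_u(Φ_{0→u}ω) du)`. -/
theorem integral_exp_neg_intervalIntegral_mul_comp_sphereTDFlow_zero
    (hG : ContDiff ℝ 2 fun q : ℝ × (Λ → E) => G q.1 q.2)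
    (hG3 : ContDiff ℝ 3 fun q : ℝ × (Λ → E) => G q.1 q.2) {H : (Λ → E) → ℝ} (hH : ContDiff ℝ 1 H)
    {c : ℝ} (hc : |c| ≤ |T| + 1) :
    ∫ ω, Real.exp (-∫ u in (0 : ℝ)..c, ∑ n, siteLaplacian n (G u)
        (sphereTDFlow hG T 0 u (fun m => ((ω : Λ → sphere (0 : E) 1) m : E)))) *
        H (sphereTDFlow hG T 0 c (fun m => (ω m : E)))
          ∂Measure.pi (fun _ : Λ => uniformSphere (volume : Measure E)) =
      ∫ ω, H (fun m => ((ω : Λ → sphere (0 : E) 1) m : E))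
        ∂Measure.pi (fun _ : Λ => uniformSphere (volume : Measure E)) :=
  integral_exp_neg_intervalIntegral_mul_comp_sphereTDFlow hG hG3 hH
    (by rw [abs_zero]; positivity) hc

/-- **EXACT REWEIGHTING OF THE FLOW MAP FOR A TILTED TARGET.**  For a jointly `C³` generator,
`|s|, |c| ≤ |T| + 1`, `S ∈ C¹`, every real `t` and every `C¹` observable `H`:
`∫ exp(ℓ_{s→c}(ω) − t·S(Φ_{s→c}ω))·H(Φ_{s→c}ω) dπ̄(ω) = ∫ e^{−tS}·H dπ̄`.
With the EFFECTIVE ACTION `S_eff = tS∘Φ_{s→c} − ℓ_{s→c}` (pulled-back action minus log-Jacobian):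
`(Φ_{s→c})_*(e^{−S_eff}π̄) = e^{−tS}π̄` in the weak form — the trivializing-map HMC is exact. -/
theorem integral_exp_sphereTDFlowLogJac_sub_mul_comp
    (hG : ContDiff ℝ 2 fun q : ℝ × (Λ → E) => G q.1 q.2)
    (hG3 : ContDiff ℝ 3 fun q : ℝ × (Λ → E) => G q.1 q.2) {S H : (Λ → E) → ℝ} (hS : ContDiff ℝ 1 S)
    (hH : ContDiff ℝ 1 H) (t : ℝ) {s c : ℝ} (hs : |s| ≤ |T| + 1) (hc : |c| ≤ |T| + 1) :
    ∫ ω, Real.exp (sphereTDFlowLogJac hG T s c (fun m => ((ω : Λ → sphere (0 : E) 1) m : E)) -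
        t * S (sphereTDFlow hG T s c (fun m => (ω m : E)))) *
        H (sphereTDFlow hG T s c (fun m => (ω m : E)))
          ∂Measure.pi (fun _ : Λ => uniformSphere (volume : Measure E)) =
      ∫ ω, Real.exp (-(t * S (fun m => ((ω : Λ → sphere (0 : E) 1) m : E)))) * H (fun m => (ω m : E))
        ∂Measure.pi (fun _ : Λ => uniformSphere (volume : Measure E)) := by
  have h := integral_exp_sphereTDFlowLogJac_mul_comp_sphereTDFlow hG hG3
    ((contDiff_exp_neg_mul hS t).mul hH) hs hc (T := T)
  rw [← h]
  refine integral_congr_ae (ae_of_all _ fun ω => ?_)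
  simp only [sub_eq_add_neg, Real.exp_add]
  ring

/-- **THE EFFECTIVE ACTION SAMPLES THE TILTED LAW EXACTLY (normalised form).**  With
`S_eff = tS∘Φ_{s→c} − ℓ_{s→c}`: `⟨H∘Φ_{s→c}⟩_{e^{−S_eff}π̄} = ⟨H⟩_{e^{−tS}π̄}` for every `C¹` observable
— the numerators and the normalising constants agree separately. -/
theorem tiltedMean_effAction_comp_sphereTDFlow_eq
    (hG : ContDiff ℝ 2 fun q : ℝ × (Λ → E) => G q.1 q.2)
    (hG3 : ContDiff ℝ 3 fun q : ℝ × (Λ → E) => G q.1 q.2) {S H : (Λ → E) → ℝ} (hS : ContDiff ℝ 1 S)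
    (hH : ContDiff ℝ 1 H) (t : ℝ) {s c : ℝ} (hs : |s| ≤ |T| + 1) (hc : |c| ≤ |T| + 1) :
    (∫ ω, Real.exp (sphereTDFlowLogJac hG T s c (fun m => ((ω : Λ → sphere (0 : E) 1) m : E)) -
          t * S (sphereTDFlow hG T s c (fun m => (ω m : E)))) *
          H (sphereTDFlow hG T s c (fun m => (ω m : E)))
            ∂Measure.pi (fun _ : Λ => uniformSphere (volume : Measure E))) /
        ∫ ω, Real.exp (sphereTDFlowLogJac hG T s c (fun m => ((ω : Λ → sphere (0 : E) 1) m : E)) -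
          t * S (sphereTDFlow hG T s c (fun m => (ω m : E))))
            ∂Measure.pi (fun _ : Λ => uniformSphere (volume : Measure E)) =
      (∫ ω, Real.exp (-(t * S (fun m => ((ω : Λ → sphere (0 : E) 1) m : E)))) * H (fun m => (ω m : E))
          ∂Measure.pi (fun _ : Λ => uniformSphere (volume : Measure E))) /
        ∫ ω, Real.exp (-(t * S (fun m => ((ω : Λ → sphere (0 : E) 1) m : E))))
          ∂Measure.pi (fun _ : Λ => uniformSphere (volume : Measure E)) := by
  have h1 := integral_exp_sphereTDFlowLogJac_sub_mul_comp hG hG3 hS hH t hs hc (T := T)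
  have h2 := integral_exp_sphereTDFlowLogJac_sub_mul_comp hG hG3 hS
    (contDiff_const (c := (1 : ℝ))) t hs hc (T := T)
  simp only [mul_one] at h2
  rw [h1, h2]

end Reweighting

/-! ## §2 The effective action is the integrated residual of Lüscher's equation -/

section Residual

variable {G : ℝ → (Λ → E) → ℝ} {T : ℝ}

/-- Along a flow line started on `Ω̃`, `u ↦ ∂̃_nS(Φ_{s→u}x)` is continuous (`S ∈ C¹`). -/
theorem continuous_siteGrad_comp_sphereTDFlow (hG : ContDiff ℝ 2 fun q : ℝ × (Λ → E) => G q.1 q.2)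
    {S : (Λ → E) → ℝ} (hS : ContDiff ℝ 1 S) (s : ℝ) {x : Λ → E} (hx : ∀ n, ‖x n‖ = 1) (n : Λ) :
    Continuous fun u : ℝ => siteGrad n S (sphereTDFlow hG T s u x) := by
  have hΦ : Continuous fun u : ℝ => sphereTDFlow hG T s u x :=
    (contDiff_sphereTDFlow hG).continuous.comp
      (continuous_const.prodMk (continuous_id.prodMk continuous_const))
  refine continuous_iff_continuousAt.2 fun u => ?_
  have hne : sphereTDFlow hG T s u x n ≠ 0 := by
    intro h0
    have h1 := norm_sphereTDFlow_eq_one hG s hx u n (T := T)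
    rw [h0, norm_zero] at h1
    exact zero_ne_one h1
  have h2 : ContinuousAt ((fun x' : Λ → E => siteGrad n S x') ∘
      fun u' : ℝ => sphereTDFlow hG T s u' x) u :=
    ContinuousAt.comp_of_eq (continuousAt_siteGrad hS n hne) hΦ.continuousAt rfl
  exact h2

/-- Along a flow line started on `Ω̃`, `u ↦ ∂̃_nG_u(Φ_{s→u}x)` is continuous (jointly `C²` generator). -/
theorem continuous_siteGrad_param_comp_sphereTDFlow
    (hG : ContDiff ℝ 2 fun q : ℝ × (Λ → E) => G q.1 q.2) (s : ℝ) {x : Λ → E} (hx : ∀ n, ‖x n‖ = 1)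
    (n : Λ) : Continuous fun u : ℝ => siteGrad n (G u) (sphereTDFlow hG T s u x) := by
  have hΦ : Continuous fun u : ℝ => ((u, sphereTDFlow hG T s u x) : ℝ × (Λ → E)) :=
    continuous_id.prodMk ((contDiff_sphereTDFlow hG).continuous.comp
      (continuous_const.prodMk (continuous_id.prodMk continuous_const)))
  refine continuous_iff_continuousAt.2 fun u => ?_
  have hne : sphereTDFlow hG T s u x n ≠ 0 := by
    intro h0
    have h1 := norm_sphereTDFlow_eq_one hG s hx u n (T := T)
    rw [h0, norm_zero] at h1
    exact zero_ne_one h1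
  have h := (contDiffAt_siteGrad_param hG n (q := (u, sphereTDFlow hG T s u x)) hne).continuousAt
  have h2 : ContinuousAt ((fun q' : ℝ × (Λ → E) => siteGrad n (G q'.1) q'.2) ∘
      fun u' : ℝ => ((u', sphereTDFlow hG T s u' x) : ℝ × (Λ → E))) u :=
    ContinuousAt.comp_of_eq h hΦ.continuousAt rfl
  exact h2

/-- Along a flow line started on `Ω̃`, `u ↦ Σ_n∂̃_n·∂̃_nG_u(Φ_{s→u}x)` is continuous (jointly `C³`
generator). -/
theorem continuous_sum_siteLaplacian_param_comp_sphereTDFlow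
    (hG : ContDiff ℝ 2 fun q : ℝ × (Λ → E) => G q.1 q.2)
    (hG3 : ContDiff ℝ 3 fun q : ℝ × (Λ → E) => G q.1 q.2) (s : ℝ) {x : Λ → E} (hx : ∀ n, ‖x n‖ = 1) :
    Continuous fun u : ℝ => ∑ n, siteLaplacian n (G u) (sphereTDFlow hG T s u x) := by
  have hΦ : Continuous fun u : ℝ => ((u, sphereTDFlow hG T s u x) : ℝ × (Λ → E)) :=
    continuous_id.prodMk ((contDiff_sphereTDFlow hG).continuous.comp
      (continuous_const.prodMk (continuous_id.prodMk continuous_const)))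
  refine continuous_finsetSum _ fun n _ => continuous_iff_continuousAt.2 fun u => ?_
  have hne : sphereTDFlow hG T s u x n ≠ 0 := by
    intro h0
    have h1 := norm_sphereTDFlow_eq_one hG s hx u n (T := T)
    rw [h0, norm_zero] at h1
    exact zero_ne_one h1
  have h := (contDiffAt_siteLaplacian_param hG3 n (q := (u, sphereTDFlow hG T s u x)) hne).continuousAt
  have h2 : ContinuousAt ((fun q' : ℝ × (Λ → E) => siteLaplacian n (G q'.1) q'.2) ∘
      fun u' : ℝ => ((u', sphereTDFlow hG T s u' x) : ℝ × (Λ → E))) u :=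
    ContinuousAt.comp_of_eq h hΦ.continuousAt rfl
  exact h2

/-- **The pulled-back action grows at the rate `S − uΣ⟨∂̃S, ∂̃G_u⟩` along the flow**: for `x ∈ Ω̃`,
`S ∈ C¹` and `|u| ≤ |T| + 1`,
`(d/du) [u·S(Φ_{s→u}x)] = S(Φ_{s→u}x) − u·Σ_n⟨∂̃_nS, ∂̃_nG_u⟩(Φ_{s→u}x)` (the true equation
`ẋ = −∂̃G_u(x)` and `DS·∂̃G = Σ⟨∂̃S, ∂̃G⟩` on `Ω̃`). -/
theorem hasDerivAt_mul_action_comp_sphereTDFlow (hG : ContDiff ℝ 2 fun q : ℝ × (Λ → E) => G q.1 q.2)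
    {S : (Λ → E) → ℝ} (hS : ContDiff ℝ 1 S) (s : ℝ) {x : Λ → E} (hx : ∀ n, ‖x n‖ = 1) {u : ℝ}
    (hu : |u| ≤ |T| + 1) :
    HasDerivAt (fun u' => u' * S (sphereTDFlow hG T s u' x))
      (S (sphereTDFlow hG T s u x) -
        u * ∑ n, ⟪siteGrad n S (sphereTDFlow hG T s u x),
          siteGrad n (G u) (sphereTDFlow hG T s u x)⟫) u := by
  have hxu : ∀ n, ‖sphereTDFlow hG T s u x n‖ = 1 := fun n => norm_sphereTDFlow_eq_one hG s hx u n
  have hγ := hasDerivAt_sphereTDFlow hG s hx hu (T := T)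
  have hSd : DifferentiableAt ℝ S (sphereTDFlow hG T s u x) := (hS.differentiable one_ne_zero) _
  have hcomp : HasDerivAt (fun u' => S (sphereTDFlow hG T s u' x))
      (fderiv ℝ S (sphereTDFlow hG T s u x)
        (fun n => -siteGrad n (G u) (sphereTDFlow hG T s u x))) u :=
    hSd.hasFDerivAt.comp_hasDerivAt u hγ
  have hneg : (fun n => -siteGrad n (G u) (sphereTDFlow hG T s u x)) =
      -fun n => siteGrad n (G u) (sphereTDFlow hG T s u x) := by
    funext n; simp
  rw [hneg, map_neg, fderiv_apply_siteGrad_eq_sum_inner hxu hSd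
    ((contDiff_of_joint hG u).differentiable (by norm_num))] at hcomp
  have h := (hasDerivAt_id' u).mul hcomp
  refine h.congr_deriv ?_
  simp only [one_mul, mul_neg]
  ring

/-- **THE EFFECTIVE ACTION IS THE INTEGRATED RESIDUAL OF LÜSCHER'S EQUATION.**  For a jointly `C³`
generator, `S ∈ C¹`, `x ∈ Ω̃` and `|s|, |c| ≤ |T| + 1`:
`c·S(Φ_{s→c}x) − s·S(x) − ℓ_{s→c}(x) = ∫_s^c (S − 𝓛_uG_u)(Φ_{s→u}x) du`.
In particular from time `0`: `S_eff(y) = c·S(Φ_{0→c}y) − ln J_c(y) = ∫_0^c (S − 𝓛_uG_u)(Φ_{0→u}y) du`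
— Lüscher's (3.9): the effective action is stationary exactly when the residual is constant. -/
theorem mul_action_comp_sub_sphereTDFlowLogJac_eq_intervalIntegral
    (hG : ContDiff ℝ 2 fun q : ℝ × (Λ → E) => G q.1 q.2)
    (hG3 : ContDiff ℝ 3 fun q : ℝ × (Λ → E) => G q.1 q.2) {S : (Λ → E) → ℝ} (hS : ContDiff ℝ 1 S)
    {x : Λ → E} (hx : ∀ n, ‖x n‖ = 1) {s c : ℝ} (hs : |s| ≤ |T| + 1) (hc : |c| ≤ |T| + 1) :
    c * S (sphereTDFlow hG T s c x) - s * S x - sphereTDFlowLogJac hG T s c x =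
      ∫ u in s..c, (S (sphereTDFlow hG T s u x) -
        sphereLuscherL S u (G u) (sphereTDFlow hG T s u x)) := by
  -- continuity of the two integrands along the flow line
  have hΦ : Continuous fun u : ℝ => sphereTDFlow hG T s u x :=
    (contDiff_sphereTDFlow hG).continuous.comp
      (continuous_const.prodMk (continuous_id.prodMk continuous_const))
  have hA : Continuous fun u : ℝ => S (sphereTDFlow hG T s u x) -
      u * ∑ n, ⟪siteGrad n S (sphereTDFlow hG T s u x),
        siteGrad n (G u) (sphereTDFlow hG T s u x)⟫ :=
    (hS.continuous.comp hΦ).sub (continuous_id.mul (continuous_finsetSum _ fun n _ =>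
      (continuous_siteGrad_comp_sphereTDFlow hG hS s hx n).inner
        (continuous_siteGrad_param_comp_sphereTDFlow hG s hx n)))
  have hB := continuous_sum_siteLaplacian_param_comp_sphereTDFlow hG hG3 s hx (T := T)
  -- the window contains the whole interval between `s` and `c`
  have hwin : ∀ u ∈ uIcc s c, |u| ≤ |T| + 1 := by
    intro u hu
    rw [uIcc, mem_Icc] at hu
    rw [abs_le] at hs hc ⊢
    constructor
    · exact le_trans (le_min hs.1 hc.1) hu.1
    · exact le_trans hu.2 (max_le hs.2 hc.2)
  -- FTC for `u ↦ u·S(Φ_{s→u}x)`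
  have hftc := intervalIntegral.integral_eq_sub_of_hasDerivAt
    (fun u hu => hasDerivAt_mul_action_comp_sphereTDFlow hG hS s hx (hwin u hu) (T := T))
    (hA.intervalIntegrable s c)
  simp only [sphereTDFlow_self] at hftc
  rw [sphereTDFlowLogJac_eq_of_norm_eq_one hG s c hx, ← hftc, sub_neg_eq_add,
    ← intervalIntegral.integral_add (hA.intervalIntegrable s c) (hB.intervalIntegrable s c)]
  refine intervalIntegral.integral_congr fun u _ => ?_
  simp only [sphereLuscherL_apply]
  ring

end Residual

/-! ## §3 The transport law between tilts; Lüscher's theorem between any two flow times -/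

section Tilts

variable [MeasurableSpace E] [BorelSpace E] [Nontrivial E] {G : ℝ → (Λ → E) → ℝ} {T : ℝ}

/-- **THE TRANSPORT LAW BETWEEN TILTS.**  For a jointly `C³` generator, `S ∈ C¹`, `|s|, |c| ≤ |T| + 1`
and every `C¹` observable `H`:
`∫ e^{−sS(ω)}·exp(−∫_s^c (S − 𝓛_uG_u)(Φ_{s→u}ω) du)·H(Φ_{s→c}ω) dπ̄(ω) = ∫ e^{−cS}·H dπ̄`
— the law `e^{−sS}π̄` transported by ANY flow from time `s` to time `c` is `e^{−cS}π̄` reweighted by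
the exponential of the integrated residual of Lüscher's equation along the trajectory. -/
theorem integral_exp_neg_mul_mul_exp_neg_residual_mul_comp
    (hG : ContDiff ℝ 2 fun q : ℝ × (Λ → E) => G q.1 q.2)
    (hG3 : ContDiff ℝ 3 fun q : ℝ × (Λ → E) => G q.1 q.2) {S H : (Λ → E) → ℝ} (hS : ContDiff ℝ 1 S)
    (hH : ContDiff ℝ 1 H) {s c : ℝ} (hs : |s| ≤ |T| + 1) (hc : |c| ≤ |T| + 1) :
    ∫ ω, Real.exp (-(s * S (fun m => ((ω : Λ → sphere (0 : E) 1) m : E)))) *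
        Real.exp (-∫ u in s..c, (S (sphereTDFlow hG T s u (fun m => (ω m : E))) -
          sphereLuscherL S u (G u) (sphereTDFlow hG T s u (fun m => (ω m : E))))) *
        H (sphereTDFlow hG T s c (fun m => (ω m : E)))
          ∂Measure.pi (fun _ : Λ => uniformSphere (volume : Measure E)) =
      ∫ ω, Real.exp (-(c * S (fun m => ((ω : Λ → sphere (0 : E) 1) m : E)))) * H (fun m => (ω m : E))
        ∂Measure.pi (fun _ : Λ => uniformSphere (volume : Measure E)) := by
  rw [← integral_exp_sphereTDFlowLogJac_sub_mul_comp hG hG3 hS hH c hs hc]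
  refine integral_congr_ae (ae_of_all _ fun ω => ?_)
  have hω : ∀ n, ‖(fun m => ((ω : Λ → sphere (0 : E) 1) m : E)) n‖ = 1 := norm_sphereConfig_eq_one ω
  have hres := mul_action_comp_sub_sphereTDFlowLogJac_eq_intervalIntegral hG hG3 hS hω hs hc (T := T)
  have hℓ : sphereTDFlowLogJac hG T s c (fun m => (ω m : E)) -
      c * S (sphereTDFlow hG T s c (fun m => (ω m : E))) =
      -(s * S (fun m => (ω m : E))) +
        -∫ u in s..c, (S (sphereTDFlow hG T s u (fun m => (ω m : E))) -
          sphereLuscherL S u (G u) (sphereTDFlow hG T s u (fun m => (ω m : E)))) := by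
    linarith
  simp only [hℓ, Real.exp_add]

/-- **LÜSCHER'S THEOREM BETWEEN ANY TWO FLOW TIMES (through the Jacobian).**  Let `G` be jointly `C³`,
`S ∈ C¹`, `|s|, |c| ≤ |T| + 1`, and suppose `G_u` solves the flow equation `𝓛_uG_u = S + C_u` on `Ω`
for every `u` between `s` and `c`.  Then for every `C¹` observable
`⟨H∘Φ_{s→c}⟩_s = ⟨H⟩_c`, i.e. `∫e^{−sS}H(Φ_{s→c}ω)dπ̄ / ∫e^{−sS}dπ̄ = ∫e^{−cS}H dπ̄ / ∫e^{−cS}dπ̄`: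
the evolution map from `s` to `c` transports the tilted law at time `s` to the tilted law at time `c`
(the residual weight `exp(∫_s^c C_u du)` is constant and cancels). -/
theorem tiltedMean_comp_sphereTDFlow_eq_of_luscher
    (hG : ContDiff ℝ 2 fun q : ℝ × (Λ → E) => G q.1 q.2)
    (hG3 : ContDiff ℝ 3 fun q : ℝ × (Λ → E) => G q.1 q.2) {S H : (Λ → E) → ℝ} (hS : ContDiff ℝ 1 S)
    (hH : ContDiff ℝ 1 H) {s c : ℝ} (hs : |s| ≤ |T| + 1) (hc : |c| ≤ |T| + 1) {C : ℝ → ℝ}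
    (hsol : ∀ u ∈ uIcc s c, ∀ ω : Λ → sphere (0 : E) 1,
      sphereLuscherL S u (G u) (fun m => (ω m : E)) = S (fun m => (ω m : E)) + C u) :
    (∫ ω, Real.exp (-(s * S (fun m => ((ω : Λ → sphere (0 : E) 1) m : E)))) *
          H (sphereTDFlow hG T s c (fun m => (ω m : E)))
            ∂Measure.pi (fun _ : Λ => uniformSphere (volume : Measure E))) /
        ∫ ω, Real.exp (-(s * S (fun m => ((ω : Λ → sphere (0 : E) 1) m : E))))
          ∂Measure.pi (fun _ : Λ => uniformSphere (volume : Measure E)) =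
      (∫ ω, Real.exp (-(c * S (fun m => ((ω : Λ → sphere (0 : E) 1) m : E)))) * H (fun m => (ω m : E))
          ∂Measure.pi (fun _ : Λ => uniformSphere (volume : Measure E))) /
        ∫ ω, Real.exp (-(c * S (fun m => ((ω : Λ → sphere (0 : E) 1) m : E))))
          ∂Measure.pi (fun _ : Λ => uniformSphere (volume : Measure E)) := by
  -- along every trajectory started on `Ω` the residual is `−C_u`, so the weight is the constant `K`
  set K : ℝ := Real.exp (-∫ u in s..c, -C u) with hK
  have hres : ∀ ω : Λ → sphere (0 : E) 1,
      Real.exp (-∫ u in s..c, (S (sphereTDFlow hG T s u (fun m => (ω m : E))) -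
        sphereLuscherL S u (G u) (sphereTDFlow hG T s u (fun m => (ω m : E))))) = K := by
    intro ω
    rw [hK]
    congr 2
    refine intervalIntegral.integral_congr fun u hu => ?_
    have hω : ∀ n, ‖sphereTDFlow hG T s u (fun m => ((ω : Λ → sphere (0 : E) 1) m : E)) n‖ = 1 :=
      fun n => norm_sphereTDFlow_eq_one hG s (norm_sphereConfig_eq_one ω) u n
    set ξ : Λ → sphere (0 : E) 1 := fun n =>
      ⟨sphereTDFlow hG T s u (fun m => (ω m : E)) n, by rw [mem_sphere_zero_iff_norm]; exact hω n⟩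
    have hξ : (fun m => ((ξ m : sphere (0 : E) 1) : E)) = sphereTDFlow hG T s u (fun m => (ω m : E)) :=
      rfl
    have h := hsol u hu ξ
    rw [hξ] at h
    simp only [h]
    ring
  have hmain : ∀ {F : (Λ → E) → ℝ}, ContDiff ℝ 1 F →
      K * ∫ ω, Real.exp (-(s * S (fun m => ((ω : Λ → sphere (0 : E) 1) m : E)))) *
          F (sphereTDFlow hG T s c (fun m => (ω m : E)))
            ∂Measure.pi (fun _ : Λ => uniformSphere (volume : Measure E)) =
        ∫ ω, Real.exp (-(c * S (fun m => ((ω : Λ → sphere (0 : E) 1) m : E)))) * F (fun m => (ω m : E))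
          ∂Measure.pi (fun _ : Λ => uniformSphere (volume : Measure E)) := by
    intro F hF
    rw [← integral_exp_neg_mul_mul_exp_neg_residual_mul_comp hG hG3 hS hF hs hc, ← integral_const_mul]
    refine integral_congr_ae (ae_of_all _ fun ω => ?_)
    simp only [hres ω]
    ring
  have hH' := hmain hH
  have h1 := hmain (contDiff_const (c := (1 : ℝ)))
  simp only [mul_one] at h1
  have hKne : K ≠ 0 := (Real.exp_pos _).ne'
  rw [← hH', ← h1, mul_div_mul_left _ _ hKne]

end Tilts

end Summit.Ventures.LatticeQCDFlow.Exactness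

end
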